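import Literature.MathematicalPhysics.QuantumFieldTheory.Balaban1983to89.T4JointDressing

/-!
# `Balaban1983to89.T4JointDressingMany` — node O3b (ii) of the uniqueness spine, `p` COMPONENTS: the two-body Mayer step of
`T4JointDressing` ITERATED over the components `Λ₀, …, Λ_{p−1}` of ONE term inside one unit block — the `p`-body coupling
sandwich with the ACCUMULATED remainder `|t|·Σ_q δ_q`, its log / D-term forms, and the consumer under the pair shape
`LoopPairOscBound` with total remainder `|t|·C₂|w|θ₂ⁿ·Σ_{i<i′}|Λᵢ||Λ_{i′}|` (cell `pub-balaban`, T4-DAG v3 §5 row T4-O3.E-ii,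
kernel item K1 of the cell record `t4/T4-EST-O3Eii.md` §2 / §3.3 (a); kernel bookkeeping over `T4JointDressing` /
`T4OscSandwich` / `T4DressedR` / `B15.BasicStep`, `Setup` vocabulary)

HONEST FRAMING (cell `pub-balaban`, T4-DAG PAGE 1).  The cell's T4 target is the existence AND uniqueness of the continuum
limit of Bałaban's unit-scale averaged loop expectations on a finite torus — a constructive-QFT statement strictly beyond
ultraviolet stability ([Balaban1989LargeFieldII] Thm 1 p. 355); it is NOT the Yang–Mills mass gap and NOT the Clay problem.
This module is a KERNEL SUB-ITEM of ONE `EST` row (T4-O3.E-ii) of that spine, announced as free kernel item "(K1) the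
p-component iteration of §3.3 (a) as a theorem over a `Finset`-indexed family of pairwise disjoint fibres with
fibre-independent factors (needs `FibreIndep` of finite products and `lmarginal` over a disjoint `Finset.biUnion` — routine)"
in the cell record `t4/T4-EST-O3Eii.md` (v1.2, sha256[:16] 729f9aa268d4a6d3) §2 (owner: unit `b2b-balaban-pv18`, whose tree
module `T4JointDressing` proves the TWO-component case and says in its docstring, verbatim: "The `p`-component case is the
iteration of §3 with `(Λ₁ ∪ ⋯ ∪ Λ_{q−1}, Λ_q)`, `q = 2, …, p` (the shape of §4 is linear in `|Λ|`, so the accumulated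
remainder is `|t|·C₂|w|θ₂^n·Σ_{i<i′}|Λᵢ||Λ_{i′}|`); it is written out in `t4/T4-EST-O3Eii.md` §3 and NOT kernel-checked here
(v1 = two components).").  DESIGN: the components are LISTED, `Λ_q = s q` for `q < p` with `s : ℕ → Finset (PBond P j)` (as
the page lists `X₁, …, Xₙ`), prefixes being `Finset.range q`; a `Finset ι`-indexed family reduces to this by any enumeration
(not spelled out).
It asserts NOTHING about Bałaban's operations or averagings: every theorem is an induction on the number of components over
`T4JointDressing.fibreIntegral_union_exp_sandwich` / `fibreIntegral_union_mul_eq` (Fubini over a union of two disjoint fibres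
plus elementary monotonicity) and finite-sum algebra; the cell's NEW estimate NE1 (ii) enters only as the HYPOTHESIS SHAPE
`T4JointDressing.LoopPairOscBound` (NOT PRINTED), consumed in §3.  Value = kernel bookkeeping (the total inter-component coupling
of the `p` components of one term at ONE basic step is controlled by the pair shape alone, with the remainder stated in the
cell record, now kernel-checked); NOT summit progress, NOT the cell's estimate NE1, NOT a proof of NE1 (ii), NOT the
hypergraph / polymer format (K2) or the `s`-body shape (K3) of the cell record, NOT any convergence condition — see "NOT given
here" below.

CITATION HEADER (lean-in-tree rule 2026-08-18).  This seat re-read the RENDERS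
`b2b-balaban-ref1/pages/1989-cmp122-large-field-I/1989-cmp122-large-field-I-p002-x2.png` (journal p. 176) and `-p027-x2.png`
(p. 201) of T. Bałaban, *Large field renormalization. I. The basic step of the ℝ operation*, Commun. Math. Phys. **122** (1989)
175–202 [Balaban1989LargeFieldI] (cell paper B15; PDF page = journal page − 174) as images, and quotes VERBATIM (the same
sentences are quoted, and were cross-read XREAD ok, in `T4JointDressing` — GAPS C-b07g5-3): p. 176 (0.2) "ρ(V) = Σ_Z ρ(Z, V)",
(0.3) "(ℝρ)(V) = Σ_Z ρ(Z″, V) ∫dV⌈_{Z′}ρ(Z, V) / ∫dV⌈_{Z′}ρ(Z″, V)", "We will prove that the densities are positive, and the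
inegration [sic] domains in the integrals above are nonempty, hence the denominators are positive, and the operation ℝ is
well defined. It satisfies the basic normalization property ∫dV(ℝρ)(V) = ∫dVρ(V). (0.4)" and "We localize them, trying to
decouple components of Z′, i.e., we write a polymer expansion, and then we exponentiate it."; p. 201 "we write Z explicitly
as a union of components, Z = X₁ ∪ ⋯ ∪ Xₙ, and we separate the summation over the admissible Z_k, n, X₁, …, Xₙ, from the
remaining summations, which are factorized in those domains.", "The integrations in (1.99) are also factorized in those
components. This way we write the expression in (1.99) in a form similar to a polymer expansion, suggesting explicitly
localization operations and an exponentiation.", the product structure "∏_{i=1}^{n} [ (1/Nᵢ) Σ … ∫dV′⌈_{Λᵢ} … ]" of (1.100),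
(1.101) "χ(Λᵢ) = χ({|(1/i) log V′(b)| < M₀ε_k for b ∈ Λᵢ})" and (1.102) "The above operation has the fundamental normalization
property ∫dV_k(ℝ′ρ_k)(V_k) = ∫dV_kρ_k(V_k).".  The manuscript is quoted for CONTEXT and SHAPE only (ONE term of (1.100) =
an insert times a PRODUCT over the `n` components `X₁, …, Xₙ` of its region of per-component normalised fibre integrals
`∫dV′⌈_{Λᵢ}`; the integrations of one term factorize over the components) — no disputed estimate of it is used anywhere
below, and nothing printed is asserted.  The pair-sensitivity hypothesis `LoopPairOscBound` is the cell's typing (module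
`T4JointDressing` §4, NOT PRINTED; its "why" is the cell record `t4/T4-EST-O3Eii.md` §1.2/§3.5) and enters §3 as a hypothesis.

THE ROW SERVED (T4-DAG v3 §5, `t4/T4-DAG.md` sha256[:16] 23f1b95b87786bbf, verbatim through the size column): "T4-O3.E-ii° |
O3b | EST | NE1 part (ii): inter-component coupling inside one unit block — joint normalisation (β) over ∪_iΛ_i or a Mayer
step restoring ∏_i of (1.100); the observable-attached polymer format with power-law locality across 𝒯(C); which B13/B16
weighted-norm loci it must survive (from O3.X2) — `Prop` + sketch — v3: = X2's obligation (A) / T4-REF-O3 V5 (iii): a Mayer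
PAIR class without d_k-decay between partners; criterion sup_{X₁}Σ_{X₂}∣v₁₂∣·weights ≪ 1 per cube against the budget ≍
∣μ∣g_j^{O(1)}M⁴(L⁴θ₁²φ²)^{K−j} | B15 p.201; B13 (2.1)/(2.13) pp.12–14; B16 (1.89) p.387; BIJ88 §4; GK86 §6; BBS15 §3–4
(shape) | O3.X2 (soft) | L |" (owner `pv18-g3`, status "in progress (kernel half LANDED …)"; this module is the
self-proposed kernel sub-row `T4-O3.E-ii.K1` of unit `b2b-balaban-pv22` gen 4 = the record's free item K1, journal CLAIM
2026-08-18T22:05:37Z, touching no existing file; K2/K3 of the record are NOT claimed).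
THE CELL-RECORD TEXT IT KERNEL-CHECKS (`t4/T4-EST-O3Eii.md` v1.2 §3.3 (a), verbatim): "Apply §1.3 to (Λ₁ ∪ ⋯ ∪ Λ_{q−1}, Λ_q),
q = 2, …, p: the product old₁⋯old_{q−1} is independent of Λ_q's fibre and bounded, and the shape (§1.2, bilinear) gives
δ_q = C₂|w|θ₂ⁿ|Λ₁ ∪ ⋯ ∪ Λ_{q−1}||Λ_q| = C₂|w|θ₂ⁿΣ_{i<q}|Λᵢ||Λ_q|. Telescoping the logs: |log N_{1…p} − Σᵢlog Nᵢ + (p −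
1)tF(V)| ≤ |t|Σ_qδ_q = |t|C₂|w|θ₂ⁿ·Σ_{i<i′}|Λᵢ||Λ_{i′}|, i.e. D_{∪Λᵢ} = ΣᵢD_{Λᵢ} + R_{1…p}, |R_{1…p}| ≤
|t|C₂|w|θ₂ⁿΣ_{i<i′}|Λᵢ||Λ_{i′}| — the TOTAL coupling of the block is controlled by the pair shape alone."  (A cell record is
NOT a citable source; it is quoted to identify WHICH bookkeeping statement is being kernel-checked.  Components are indexed
here from `0`: `Λ_q = s q`, `q < p`.)

DICTIONARY (as in `B15.BasicStep` / `T4DressedR` / `T4JointDressing`): a fibre `s q : Finset (PBond P j)` = the bond variables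
`Λ_q` of the `q`-th component integrated out, the family `s : ℕ → Finset (PBond P j)` PAIRWISE DISJOINT on `q < p`; `V←y :=
Function.updateFinset V Λ y`; `fibreIntegral Λ f V = ∫dV′⌈_Λ f` (normalized Haar, Mathlib `lmarginal`); per-component integrated
densities `old q` (measurable, `0 ≤ old q ≤ C`, supported in the small-field domain when §3 needs it), the `q`-th INDEPENDENT
of every other component's variables (`T4DressedR.FibreIndep (s i) (old q)`, `i ≠ q`), the factorised data of the term being
`∏_{q<p} old q`; the prefix union `Λ₀ ∪ ⋯ ∪ Λ_{q−1} = (Finset.range q).biUnion s` and prefix product `∏_{i<q} old i`; the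
dressing `e^{tF}`, in §3 `F = T4OscSandwich.loopDressing av j n x w = W_C∘avg^n`; `N_q := ∫dV⌈_{Λ_q}(old_q·e^{tF})(V)`,
`N_{0…p−1} := ∫dV⌈_{Λ₀∪⋯∪Λ_{p−1}}(∏_q old_q·e^{tF})(V)`, and the NORMALISED currency `Ñ := e^{−tF(V)}·N` in which the two-body
step of `T4JointDressing` §3 reads `e^{−|t|δ}Ñ₁Ñ₂ ≤ Ñ₁₂ ≤ e^{|t|δ}Ñ₁Ñ₂` and iterates cleanly.

CONTENTS.  Every `theorem` below is tagged [folklore] (Fubini + monotonicity + finite-sum algebra over Mathlib and the tree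
modules named); nothing is tagged as a printed result except the `p`-fold exact factorisation, which is the kernel form of the
p. 201 sentence quoted above (as its two-fold parent in `T4JointDressing` §2).
§0 `updateFinset_union_eq` (an update on `s ∪ t` = update on `s` then on `t`, no disjointness needed),
   `updateFinset_eq_self_of_forall_not_mem`; FIBRE-INDEPENDENCE ALGEBRA: `fibreIndep_empty`, `FibreIndep.union`,
   `fibreIndep_biUnion`, `FibreIndep.mul`, `fibreIndep_prod`; the PREFIX lemmas of a pairwise-disjoint, mutually independent
   family: `disjoint_biUnion_range` (`Λ₀∪⋯∪Λ_{q−1}` is disjoint from `Λ_q`), `fibreIndep_biUnion_range` (`old q` ignores the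
   prefix fibre), `fibreIndep_prod_range` (the prefix product ignores `Λ_q`), `measurable_prod_range`, `prod_range_nonneg`,
   `prod_range_le_pow` (common bound `(max C 1)^{p′}`).
§1 `fibreIntegral_empty` (`∫⌈_∅ f = f`); `fibreIntegral_biUnion_prod_eq`: the `p`-FOLD EXACT FACTORISATION
   `∫dV⌈_{∪Λ_q}∏_q old_q = ∏_q ∫dV⌈_{Λ_q}old_q` (p. 201, `n` components; `T4JointDressing.fibreIntegral_union_mul_eq` iterated).
§2 THE `p`-BODY COUPLING SANDWICH `fibreIntegral_biUnion_exp_sandwich` (K1): under per-prefix mixed-difference bounds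
   `|F(V←y←z) − F(V←y) − F(V←z) + F(V)| ≤ δ q` (`y` on `Λ₀∪⋯∪Λ_{q−1}`, `z` on `Λ_q`, only where the densities are non-zero),
   `e^{−|t|Σ_qδ_q}·∏_q Ñ_q ≤ Ñ_{0…p−1} ≤ e^{|t|Σ_qδ_q}·∏_q Ñ_q`; `fibreIntegral_biUnion_exp_sandwich'`: the same in the printed
   currency, `e^{−|t|Σδ}e^{−(p−1)tF(V)}∏_qN_q ≤ N_{0…p−1} ≤ e^{|t|Σδ}e^{−(p−1)tF(V)}∏_qN_q`; `abs_log_coupling_sum_le`: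
   `|log N_{0…p−1} − Σ_q log N_q + (p−1)tF(V)| ≤ |t|Σ_qδ_q` (dressed fluctuation integrals are positive when the undressed ones
   are non-zero — the printed proviso p. 176); `abs_defect_biUnion_sub_sum_le`: in D-TERM form (any convention
   `D_Λ = log(∫⌈_Λ(old·e^{tF})/∫⌈_Λ old) − tF(V)`), `D_{∪Λ_q} = Σ_q D_{Λ_q} + R`, `|R| ≤ |t|Σ_qδ_q`.
§3 CONSUMER (WHERE NE1 (ii) IS SPENT FOR `p` COMPONENTS): `prefix_pair_remainder_eq` / `sum_prefix_pair_remainder_eq` — the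
   UNION RULE: the pair shape is linear in `|Λ|`, so the prefix remainder `C₂|w||Λ₀∪⋯∪Λ_{q−1}||Λ_q|θ₂ⁿ` is
   `C₂|w|θ₂ⁿΣ_{i<q}|Λᵢ||Λ_q|` (`Finset.card_biUnion`) and the accumulated one is `C₂|w|θ₂ⁿΣ_{q<p}Σ_{i<q}|Λᵢ||Λ_q|`;
   `fibreIntegral_biUnion_loopDressing_sandwich`: under `LoopPairOscBound av dom C₂ θ₂`, for densities SUPPORTED IN THE
   DOMAIN (`old q U ≠ 0 → U ∈ dom j` — the small-field characteristic functions (1.101)) and a base point `V ∈ dom j`, the §2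
   sandwich holds for `F = loopDressing av j n x w` with `Σ_qδ_q = C₂·|w|·θ₂ⁿ·Σ_{i<i′}|Λᵢ||Λ_{i′}|` (the four configurations of
   each prefix rectangle lie in the domain by fibre independence and `T4JointDressing.updateFinset_updateFinset_comm`, and
   `LoopPairOscBound.updateFinset` applies to the DISJOINT pair `(Λ₀∪⋯∪Λ_{q−1}, Λ_q)`); `abs_log_loopDressing_coupling_sum_le`:
   its log form.
§4 COUNTING [arith]: `two_mul_sum_sum_range_add_sum_sq` (`2Σ_{i<i′}aᵢa_{i′} + Σa_q² = (Σa_q)²`),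
   `sum_sum_range_mul_le_sq_half` (`Σ_{i<i′}aᵢa_{i′} ≤ (Σa_q)²/2`), `sum_sum_range_mul_le_of_le` (`aᵢ ≤ Λmax` ⇒
   `Σ_{i<i′}aᵢa_{i′} ≤ Λmax²·p(p−1)/2` — the per-block count of the cell record §3.4 (i)).

NOT GIVEN HERE (located, cell record `t4/T4-EST-O3Eii.md` §2/§3.3 (b)/§3.4): (K2) the Möbius / «+1 −1» HYPERGRAPH FORMAT
(distribution of the total remainder `R` into observable-attached polymers with individual activities) and (K3) the `s`-body
shape `LoopMixedOscBound` — both remain free items of the record; any RATE (`θ₂ < 1`, NE1 (ii) proper: `LoopPairOscBound`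
holds trivially with `(4, 1)`, `T4JointDressing.loopPairOscBound_four_one`, so §3 is non-vacuous but carries no decay by
itself); the complex-analytic (norm ‖·‖_k) versions; any convergence condition (`θ₂L⁴ ≤ 1` etc., §3.4 (ii) of the record is
[arith]/[analysis] on paper only); the survival of the remainders through later T/R steps (T4-XREAD-O3X2 obligations); the
separated shape `LoopPairOscBoundSep` of `T4JointDressing` §6 (its `p`-component iteration is the same induction with
`δ_q` read from `.updateFinset` of the separated shape and is not spelled out).  LOCATED ROLE (cell record `t4/T4-REF-O3.md`
V3/V5, binding): the accumulated remainder is a ONE-STEP / `μ`-RADIUS quantity (what keeps `log N_{0…p−1}` and the D-terms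
analytic and small in `|t|` at the birth step), NOT the size booked across scales by (TOB-k).
Imports `T4JointDressing` only (hence `T4OscSandwich`, `T4DressedR`, `T4AvgSensitivity`, `B15.BasicStep`); Mathlib otherwise; no
`sorry` / `axiom`; no `def` (statements are over `Finset.range`, `Finset.biUnion`, `Finset.prod` directly).  Unit
`b2b-balaban-pv22` gen 4 (SURGE NODE PROVER #22; journal CLAIM `T4-O3.E-ii.K1*`); records GAPS C-pv22g4-1.
-/

open scoped BigOperators ENNReal
open _root_.MeasureTheory Function Finset

namespace Literature.MathematicalPhysics.QuantumFieldTheory.Balaban1983to89.T4JointDressingMany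

open B15.BasicStep T4DressedR T4Continuum T4AvgSensitivity T4OscSandwich T4JointDressing

/-! ## §0 Coordinate updates on a union; fibre independence of unions and of finite products -/

/-- An update on `s ∪ t` is an update on `s` followed by an update on `t` with the restricted data (no disjointness
needed: on `s ∩ t` both prescribe the same values). [folklore] -/
theorem updateFinset_union_eq {ι : Type*} [DecidableEq ι] {π : ι → Type*} (x : ∀ i, π i) (s t : Finset ι)
    (y : ∀ i : ↥(s ∪ t), π i) :
    updateFinset x (s ∪ t) y
      = updateFinset (updateFinset x s (fun i => y ⟨i, mem_union_left t i.2⟩)) t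
          (fun i => y ⟨i, mem_union_right s i.2⟩) := by
  funext i
  by_cases ht : i ∈ t
  · simp only [updateFinset, dif_pos ht, dif_pos (mem_union_right s ht)]
  · by_cases hs : i ∈ s
    · simp only [updateFinset, dif_neg ht, dif_pos hs, dif_pos (mem_union_left t hs)]
    · have hst : i ∉ s ∪ t := by simp [hs, ht]
      simp only [updateFinset, dif_neg ht, dif_neg hs, dif_neg hst]

/-- An update on a finite set NONE of whose members is present changes nothing: if no index lies in `s`
(e.g. `s = (range 0).biUnion _`), `updateFinset x s y = x`. [folklore] -/
theorem updateFinset_eq_self_of_forall_not_mem {ι : Type*} [DecidableEq ι] {π : ι → Type*} (x : ∀ i, π i)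
    {s : Finset ι} (hs : ∀ i, i ∉ s) (y : ∀ i : ↥s, π i) : updateFinset x s y = x :=
  funext fun i => by simp only [updateFinset, dif_neg (hs i)]

section Indep

variable {P : Params} {j : ℕ} {G : Type*} [DecidableEq (PBond P j)]

/-- The empty fibre: every density is independent of no variables. [folklore] -/
theorem fibreIndep_empty (w : Density P j G) : FibreIndep (∅ : Finset (PBond P j)) w :=
  fun x y => by rw [updateFinset_empty]

/-- Fibre independence is stable under UNION of fibres. [folklore] -/
theorem FibreIndep.union {s t : Finset (PBond P j)} {w : Density P j G} (hs : FibreIndep s w)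
    (ht : FibreIndep t w) : FibreIndep (s ∪ t) w := fun x y => by
  rw [updateFinset_union_eq, ht, hs]

/-- … hence under finite unions `I.biUnion s`. [folklore] -/
theorem fibreIndep_biUnion {ι : Type*} [DecidableEq ι] (I : Finset ι) (s : ι → Finset (PBond P j))
    {w : Density P j G} (h : ∀ i ∈ I, FibreIndep (s i) w) : FibreIndep (I.biUnion s) w := by
  induction I using Finset.cons_induction with
  | empty => rw [biUnion_empty]; exact fibreIndep_empty w
  | cons a I ha ih =>
    rw [cons_eq_insert, biUnion_insert]
    exact FibreIndep.union (h a (mem_cons_self a I)) (ih fun i hi => h i (mem_cons.2 (Or.inr hi)))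

/-- A product of two `s`-independent densities is `s`-independent. [folklore] -/
theorem FibreIndep.mul {s : Finset (PBond P j)} {f g : Density P j G} (hf : FibreIndep s f) (hg : FibreIndep s g) :
    FibreIndep s (fun U => f U * g U) := fun x y => by
  show f _ * g _ = f x * g x
  rw [hf x y, hg x y]

/-- A finite product of `s`-independent densities is `s`-independent. [folklore] -/
theorem fibreIndep_prod {ι : Type*} (I : Finset ι) {s : Finset (PBond P j)} {f : ι → Density P j G}
    (h : ∀ i ∈ I, FibreIndep s (f i)) : FibreIndep s (fun U => ∏ i ∈ I, f i U) := fun x y =>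
  Finset.prod_congr rfl fun i hi => h i hi x y

/-- PREFIX DISJOINTNESS: in a family of `p` pairwise-disjoint fibres, the union of the first `q` is disjoint from the
`q`-th (`q < p`). [folklore] -/
theorem disjoint_biUnion_range {p : ℕ} {s : ℕ → Finset (PBond P j)}
    (hdisj : ∀ i < p, ∀ i' < p, i ≠ i' → Disjoint (s i) (s i')) {q : ℕ} (hq : q < p) :
    Disjoint ((range q).biUnion s) (s q) :=
  (disjoint_biUnion_left _ _ _).2 fun i hi =>
    hdisj i ((mem_range.1 hi).trans hq) q hq (mem_range.1 hi).ne

/-- PREFIX INDEPENDENCE (a): the `q`-th density does not depend on the variables of the first `q` fibres. [folklore] -/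
theorem fibreIndep_biUnion_range {p : ℕ} {s : ℕ → Finset (PBond P j)} {old : ℕ → Density P j G}
    (hI : ∀ i < p, ∀ i' < p, i ≠ i' → FibreIndep (s i') (old i)) {q : ℕ} (hq : q < p) :
    FibreIndep ((range q).biUnion s) (old q) :=
  fibreIndep_biUnion _ _ fun i hi => hI q hq i ((mem_range.1 hi).trans hq) (mem_range.1 hi).ne'

/-- PREFIX INDEPENDENCE (b): the product of the first `q` densities does not depend on the `q`-th fibre. [folklore] -/
theorem fibreIndep_prod_range {p : ℕ} {s : ℕ → Finset (PBond P j)} {old : ℕ → Density P j G}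
    (hI : ∀ i < p, ∀ i' < p, i ≠ i' → FibreIndep (s i') (old i)) {q : ℕ} (hq : q < p) :
    FibreIndep (s q) (fun U => ∏ i ∈ range q, old i U) :=
  fibreIndep_prod _ fun i hi => hI i ((mem_range.1 hi).trans hq) q hq (mem_range.1 hi).ne

end Indep

section Bounds

variable {P : Params} {j : ℕ} {G : Type*}

/-- The prefix product of measurable densities is measurable. [folklore] -/
theorem measurable_prod_range [MeasurableSpace G] {p : ℕ} {old : ℕ → Density P j G}
    (hm : ∀ i < p, Measurable (old i)) {q : ℕ}
    (hq : q ≤ p) : Measurable (fun U : GaugeField P j G => ∏ i ∈ range q, old i U) :=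
  Finset.measurable_prod _ fun i hi => hm i (lt_of_lt_of_le (mem_range.1 hi) hq)

/-- … non-negative. [folklore] -/
theorem prod_range_nonneg {p : ℕ} {old : ℕ → Density P j G} (h0 : ∀ i < p, ∀ U, 0 ≤ old i U) {q : ℕ}
    (hq : q ≤ p) (U : GaugeField P j G) : 0 ≤ ∏ i ∈ range q, old i U :=
  prod_nonneg fun i hi => h0 i (lt_of_lt_of_le (mem_range.1 hi) hq) U

/-- … and bounded by `(max C 1)^q ≤ (max C 1)^p'` for any `p' ≥ q` (a common bound for all prefix blocks). [folklore] -/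
theorem prod_range_le_pow {p : ℕ} {old : ℕ → Density P j G} (h0 : ∀ i < p, ∀ U, 0 ≤ old i U) {C : ℝ}
    (hC : ∀ i < p, ∀ U, old i U ≤ C) {q : ℕ} (hq : q ≤ p) {p' : ℕ} (hp' : q ≤ p') (U : GaugeField P j G) :
    ∏ i ∈ range q, old i U ≤ (max C 1) ^ p' :=
  calc ∏ i ∈ range q, old i U
      ≤ ∏ _i ∈ range q, max C 1 :=
        prod_le_prod (fun i hi => h0 i (lt_of_lt_of_le (mem_range.1 hi) hq) U)
          (fun i hi => (hC i (lt_of_lt_of_le (mem_range.1 hi) hq) U).trans (le_max_left _ _))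
    _ = (max C 1) ^ q := by rw [prod_const, card_range]
    _ ≤ (max C 1) ^ p' := pow_le_pow_right₀ (le_max_right _ _) hp'

end Bounds

section SetupLevel

variable {P : Params} {j : ℕ} {G : Type*} [GaugeGroup G] [MeasurableSpace G] [HaarData G]
variable [DecidableEq (PBond P j)]

/-! ## §1 The empty fibre and the `p`-fold factorisation of undressed fibre integrals -/

/-- The integral over the EMPTY fibre is evaluation (for a value `f V ≥ 0`; `toReal ∘ ofReal`). [folklore] -/
theorem fibreIntegral_empty {f : Density P j G} (V : GaugeField P j G) (h0 : 0 ≤ f V) :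
    fibreIntegral (∅ : Finset (PBond P j)) f V = f V := by
  simp only [fibreIntegral, lmarginal_empty, ENNReal.toReal_ofReal h0]

/-- `p`-FOLD EXACT FACTORISATION ("The integrations in (1.99) are also factorized in those components", p. 201, for
`n` components): for pairwise-disjoint fibres `Λ₀, …, Λ_{p−1}` and measurable densities `0 ≤ oldᵢ ≤ C`, the `i`-th
independent of every other fibre, `∫dV⌈_{Λ₀∪⋯∪Λ_{p−1}} ∏ᵢ oldᵢ = ∏ᵢ ∫dV⌈_{Λᵢ} oldᵢ` pointwise — the two-fibre theorem
`T4JointDressing.fibreIntegral_union_mul_eq` iterated over the prefix pairs `(Λ₀∪⋯∪Λ_{q−1}, Λ_q)`. [cite: Balaban1989LargeFieldI, p.201 l.13] -/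
theorem fibreIntegral_biUnion_prod_eq (p : ℕ) {s : ℕ → Finset (PBond P j)}
    (hdisj : ∀ i < p, ∀ i' < p, i ≠ i' → Disjoint (s i) (s i')) {old : ℕ → Density P j G}
    (hm : ∀ i < p, Measurable (old i)) (h0 : ∀ i < p, ∀ U, 0 ≤ old i U) {C : ℝ} (hC : ∀ i < p, ∀ U, old i U ≤ C)
    (hI : ∀ i < p, ∀ i' < p, i ≠ i' → FibreIndep (s i') (old i)) (V : GaugeField P j G) :
    fibreIntegral ((range p).biUnion s) (fun U => ∏ i ∈ range p, old i U) V
      = ∏ i ∈ range p, fibreIntegral (s i) (old i) V := by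
  induction p with
  | zero =>
    have hf : (fun U : GaugeField P j G => ∏ i ∈ range 0, old i U) = fun _ => 1 :=
      funext fun U => by rw [range_zero, prod_empty]
    rw [hf, prod_range_zero, range_zero, biUnion_empty, fibreIntegral_empty (f := fun _ => (1 : ℝ)) V zero_le_one]
  | succ q ih =>
    have hq : q < q + 1 := Nat.lt_succ_self q
    have ih' := ih (fun i hi i' hi' => hdisj i (hi.trans hq) i' (hi'.trans hq)) (fun i hi => hm i (hi.trans hq))
      (fun i hi => h0 i (hi.trans hq)) (fun i hi => hC i (hi.trans hq))
      (fun i hi i' hi' => hI i (hi.trans hq) i' (hi'.trans hq))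
    have hU : (range (q + 1)).biUnion s = (range q).biUnion s ∪ s q := by
      rw [range_add_one, biUnion_insert, union_comm]
    have hf : (fun U : GaugeField P j G => ∏ i ∈ range (q + 1), old i U)
        = fun U => (∏ i ∈ range q, old i U) * old q U := funext fun U => prod_range_succ _ _
    rw [hU, hf, prod_range_succ, ← ih']
    exact fibreIntegral_union_mul_eq (disjoint_biUnion_range hdisj hq) (measurable_prod_range hm hq.le) (hm q hq)
      (prod_range_nonneg h0 hq.le) (prod_range_le_pow h0 hC hq.le le_rfl) (hC q hq)
      (fibreIndep_prod_range hI hq) (fibreIndep_biUnion_range hI hq) V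

/-! ## §2 The `p`-body coupling sandwich: iterating the two-body Mayer step over `(Λ₀ ∪ ⋯ ∪ Λ_{q−1}, Λ_q)` -/

/-- `p`-BODY COUPLING SANDWICH (K1: the two-body step `T4JointDressing.fibreIntegral_union_exp_sandwich` iterated over the
prefix pairs `(Λ₀ ∪ ⋯ ∪ Λ_{q−1}, Λ_q)`, `q < p`).  Data: `p` pairwise-disjoint integration domains `Λ_q = s q` of ONE term;
integrated densities `old q`, measurable, `0 ≤ old q ≤ C`, the `q`-th independent of every other fibre; a measurable bounded
exponent `F` (`|F| ≤ B`); and for each `q < p` a bound `δ q` on the MIXED SECOND DIFFERENCE of `F` across the prefix pair on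
the joint fibre through `V` (only where the densities are non-zero):
`|F(V←y←z) − F(V←y) − F(V←z) + F(V)| ≤ δ q` for `y` a coordinate of the fibre `Λ₀ ∪ ⋯ ∪ Λ_{q−1}`, `z` of `Λ_q`.
Conclusion, in the `e^{−tF(V)}`-NORMALISED currency `Ñ := e^{−tF(V)}·∫dV⌈(…·e^{tF})(V)` (in which the two-body step reads
`e^{−|t|δ}Ñ₁Ñ₂ ≤ Ñ₁₂ ≤ e^{|t|δ}Ñ₁Ñ₂`):  `e^{−|t|Σ_q δ_q}·∏_q Ñ_q ≤ Ñ_{0…p−1} ≤ e^{|t|Σ_q δ_q}·∏_q Ñ_q`. [folklore] -/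
theorem fibreIntegral_biUnion_exp_sandwich (p : ℕ) {s : ℕ → Finset (PBond P j)}
    (hdisj : ∀ i < p, ∀ i' < p, i ≠ i' → Disjoint (s i) (s i')) {old : ℕ → Density P j G} (F : Density P j G)
    (hm : ∀ i < p, Measurable (old i)) (hF : Measurable F) (h0 : ∀ i < p, ∀ U, 0 ≤ old i U) {C : ℝ}
    (hC : ∀ i < p, ∀ U, old i U ≤ C) (hI : ∀ i < p, ∀ i' < p, i ≠ i' → FibreIndep (s i') (old i)) {B : ℝ}
    (hFB : ∀ U, |F U| ≤ B) (t : ℝ) (δ : ℕ → ℝ) (V : GaugeField P j G)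
    (hmix : ∀ q < p, ∀ (y : ↥((range q).biUnion s) → G) (z : ↥(s q) → G),
      (∀ i < q, old i (updateFinset V ((range q).biUnion s) y) ≠ 0) → old q (updateFinset V (s q) z) ≠ 0 →
      |F (updateFinset (updateFinset V ((range q).biUnion s) y) (s q) z) - F (updateFinset V ((range q).biUnion s) y)
          - F (updateFinset V (s q) z) + F V| ≤ δ q) :
    Real.exp (-(|t| * ∑ q ∈ range p, δ q)) *
        ∏ i ∈ range p, (Real.exp (-(t * F V)) * fibreIntegral (s i) (fun U => old i U * Real.exp (t * F U)) V)
      ≤ Real.exp (-(t * F V)) *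
        fibreIntegral ((range p).biUnion s) (fun U => (∏ i ∈ range p, old i U) * Real.exp (t * F U)) V ∧
    Real.exp (-(t * F V)) *
        fibreIntegral ((range p).biUnion s) (fun U => (∏ i ∈ range p, old i U) * Real.exp (t * F U)) V
      ≤ Real.exp (|t| * ∑ q ∈ range p, δ q) *
        ∏ i ∈ range p, (Real.exp (-(t * F V)) * fibreIntegral (s i) (fun U => old i U * Real.exp (t * F U)) V) := by
  induction p with
  | zero =>
    have hf : (fun U : GaugeField P j G => (∏ i ∈ range 0, old i U) * Real.exp (t * F U))
        = fun U => Real.exp (t * F U) := funext fun U => by rw [range_zero, prod_empty, one_mul]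
    have e : Real.exp (-(t * F V)) * Real.exp (t * F V) = 1 := by
      rw [← Real.exp_add, neg_add_cancel, Real.exp_zero]
    rw [hf, sum_range_zero, prod_range_zero, range_zero, biUnion_empty,
      fibreIntegral_empty (f := fun U => Real.exp (t * F U)) V (Real.exp_pos _).le, e, mul_zero, neg_zero,
      Real.exp_zero, one_mul]
    exact ⟨le_rfl, le_rfl⟩
  | succ q ih =>
    have hq : q < q + 1 := Nat.lt_succ_self q
    obtain ⟨ihL, ihU⟩ := ih (fun i hi i' hi' => hdisj i (hi.trans hq) i' (hi'.trans hq))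
      (fun i hi => hm i (hi.trans hq)) (fun i hi => h0 i (hi.trans hq)) (fun i hi => hC i (hi.trans hq))
      (fun i hi i' hi' => hI i (hi.trans hq) i' (hi'.trans hq)) (fun q' hq' => hmix q' (hq'.trans hq))
    have hd : Disjoint ((range q).biUnion s) (s q) := disjoint_biUnion_range hdisj hq
    -- the two-body step for the prefix pair `(Λ₀ ∪ ⋯ ∪ Λ_{q−1}, Λ_q)`
    have two := fibreIntegral_union_exp_sandwich hd (old₁ := fun U => ∏ i ∈ range q, old i U) (old₂ := old q) F
      (measurable_prod_range hm hq.le) (hm q hq) hF (prod_range_nonneg h0 hq.le) (h0 q hq)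
      (prod_range_le_pow h0 hC hq.le (Nat.le_succ q))
      (fun U => (hC q hq U).trans ((le_max_left C 1).trans
        (le_self_pow₀ (le_max_right C 1) (Nat.succ_ne_zero q))))
      (fibreIndep_prod_range hI hq) (fibreIndep_biUnion_range hI hq) hFB t (δ q) V
      (fun y z hy hz => hmix q hq y z (fun i hi => (prod_ne_zero_iff.1 hy) i (mem_range.2 hi)) hz)
    -- rewrite the `(q+1)`-fold joint integral as the two-body joint integral of the prefix pair
    have hU : (range (q + 1)).biUnion s = (range q).biUnion s ∪ s q := by
      rw [range_add_one, biUnion_insert, union_comm]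
    have hf : (fun U : GaugeField P j G => (∏ i ∈ range (q + 1), old i U) * Real.exp (t * F U))
        = fun U => (∏ i ∈ range q, old i U) * old q U * Real.exp (t * F U) :=
      funext fun U => by rw [prod_range_succ]
    rw [hU, hf, sum_range_succ, prod_range_succ]
    -- bookkeeping
    set a := Real.exp (-(t * F V)) with ha
    set Nq := fibreIntegral ((range q).biUnion s) (fun U => (∏ i ∈ range q, old i U) * Real.exp (t * F U)) V
    set nq := fibreIntegral (s q) (fun U => old q U * Real.exp (t * F U)) V
    set N' := fibreIntegral ((range q).biUnion s ∪ s q)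
      (fun U => (∏ i ∈ range q, old i U) * old q U * Real.exp (t * F U)) V
    set Pq := ∏ i ∈ range q, (a * fibreIntegral (s i) (fun U => old i U * Real.exp (t * F U)) V)
    set Sq := ∑ i ∈ range q, δ i
    have ha0 : 0 < a := Real.exp_pos _
    have hnq0 : 0 ≤ nq := fibreIntegral_nonneg _ _ _
    have twoL : Real.exp (-(|t| * δ q)) * (a * Nq) * (a * nq) ≤ a * N' := by
      have h := mul_le_mul_of_nonneg_left two.1 ha0.le
      calc Real.exp (-(|t| * δ q)) * (a * Nq) * (a * nq) = a * (Real.exp (-(|t| * δ q)) * a * (Nq * nq)) := by ring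
        _ ≤ a * N' := h
    have twoU : a * N' ≤ Real.exp (|t| * δ q) * (a * Nq) * (a * nq) := by
      have h := mul_le_mul_of_nonneg_left two.2 ha0.le
      calc a * N' ≤ a * (Real.exp (|t| * δ q) * a * (Nq * nq)) := h
        _ = Real.exp (|t| * δ q) * (a * Nq) * (a * nq) := by ring
    constructor
    · calc Real.exp (-(|t| * (Sq + δ q))) * (Pq * (a * nq))
          = Real.exp (-(|t| * δ q)) * (Real.exp (-(|t| * Sq)) * Pq) * (a * nq) := by
            rw [mul_add, neg_add, Real.exp_add]; ring
        _ ≤ Real.exp (-(|t| * δ q)) * (a * Nq) * (a * nq) :=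
            mul_le_mul_of_nonneg_right (mul_le_mul_of_nonneg_left ihL (Real.exp_pos _).le) (mul_nonneg ha0.le hnq0)
        _ ≤ a * N' := twoL
    · calc a * N' ≤ Real.exp (|t| * δ q) * (a * Nq) * (a * nq) := twoU
        _ ≤ Real.exp (|t| * δ q) * (Real.exp (|t| * Sq) * Pq) * (a * nq) :=
            mul_le_mul_of_nonneg_right (mul_le_mul_of_nonneg_left ihU (Real.exp_pos _).le) (mul_nonneg ha0.le hnq0)
        _ = Real.exp (|t| * (Sq + δ q)) * (Pq * (a * nq)) := by rw [mul_add, Real.exp_add]; ring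

/-- … THE SAME IN THE PRINTED CURRENCY (cell record `t4/T4-EST-O3Eii.md` §3.3 (a)): with `N_q := ∫dV⌈_{Λ_q}(old_q·e^{tF})(V)`
and `N_{0…p−1} := ∫dV⌈_{∪Λ_q}(∏_q old_q·e^{tF})(V)`,
`e^{−|t|Σδ}·e^{−(p−1)tF(V)}·∏_q N_q ≤ N_{0…p−1} ≤ e^{|t|Σδ}·e^{−(p−1)tF(V)}·∏_q N_q` — the jointly dressed fluctuation
integral over `p` components factorises up to `e^{±|t|Σ_q δ_q}`. [folklore] -/
theorem fibreIntegral_biUnion_exp_sandwich' (p : ℕ) {s : ℕ → Finset (PBond P j)}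
    (hdisj : ∀ i < p, ∀ i' < p, i ≠ i' → Disjoint (s i) (s i')) {old : ℕ → Density P j G} (F : Density P j G)
    (hm : ∀ i < p, Measurable (old i)) (hF : Measurable F) (h0 : ∀ i < p, ∀ U, 0 ≤ old i U) {C : ℝ}
    (hC : ∀ i < p, ∀ U, old i U ≤ C) (hI : ∀ i < p, ∀ i' < p, i ≠ i' → FibreIndep (s i') (old i)) {B : ℝ}
    (hFB : ∀ U, |F U| ≤ B) (t : ℝ) (δ : ℕ → ℝ) (V : GaugeField P j G)
    (hmix : ∀ q < p, ∀ (y : ↥((range q).biUnion s) → G) (z : ↥(s q) → G),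
      (∀ i < q, old i (updateFinset V ((range q).biUnion s) y) ≠ 0) → old q (updateFinset V (s q) z) ≠ 0 →
      |F (updateFinset (updateFinset V ((range q).biUnion s) y) (s q) z) - F (updateFinset V ((range q).biUnion s) y)
          - F (updateFinset V (s q) z) + F V| ≤ δ q) :
    Real.exp (-(|t| * ∑ q ∈ range p, δ q)) * Real.exp (-(((p : ℝ) - 1) * (t * F V))) *
        ∏ i ∈ range p, fibreIntegral (s i) (fun U => old i U * Real.exp (t * F U)) V
      ≤ fibreIntegral ((range p).biUnion s) (fun U => (∏ i ∈ range p, old i U) * Real.exp (t * F U)) V ∧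
    fibreIntegral ((range p).biUnion s) (fun U => (∏ i ∈ range p, old i U) * Real.exp (t * F U)) V
      ≤ Real.exp (|t| * ∑ q ∈ range p, δ q) * Real.exp (-(((p : ℝ) - 1) * (t * F V))) *
        ∏ i ∈ range p, fibreIntegral (s i) (fun U => old i U * Real.exp (t * F U)) V := by
  obtain ⟨hL, hU⟩ := fibreIntegral_biUnion_exp_sandwich p hdisj F hm hF h0 hC hI hFB t δ V hmix
  set a := Real.exp (-(t * F V)) with ha
  set N := fibreIntegral ((range p).biUnion s) (fun U => (∏ i ∈ range p, old i U) * Real.exp (t * F U)) V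
  set P₀ := ∏ i ∈ range p, fibreIntegral (s i) (fun U => old i U * Real.exp (t * F U)) V
  have hb0 : 0 < Real.exp (t * F V) := Real.exp_pos _
  have hP : ∏ i ∈ range p, (a * fibreIntegral (s i) (fun U => old i U * Real.exp (t * F U)) V) = a ^ p * P₀ := by
    rw [prod_mul_distrib, prod_const, card_range]
  have hkey : Real.exp (t * F V) * a ^ p = Real.exp (-(((p : ℝ) - 1) * (t * F V))) := by
    rw [ha, ← Real.exp_nat_mul, ← Real.exp_add]
    congr 1; ring
  have hinv : Real.exp (t * F V) * a = 1 := by rw [ha, ← Real.exp_add, add_neg_cancel, Real.exp_zero]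
  rw [hP] at hL hU
  constructor
  · have h := mul_le_mul_of_nonneg_left hL hb0.le
    calc Real.exp (-(|t| * ∑ q ∈ range p, δ q)) * Real.exp (-(((p : ℝ) - 1) * (t * F V))) * P₀
        = Real.exp (t * F V) * (Real.exp (-(|t| * ∑ q ∈ range p, δ q)) * (a ^ p * P₀)) := by rw [← hkey]; ring
      _ ≤ Real.exp (t * F V) * (a * N) := h
      _ = N := by rw [← mul_assoc, hinv, one_mul]
  · have h := mul_le_mul_of_nonneg_left hU hb0.le
    calc N = Real.exp (t * F V) * (a * N) := by rw [← mul_assoc, hinv, one_mul]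
      _ ≤ Real.exp (t * F V) * (Real.exp (|t| * ∑ q ∈ range p, δ q) * (a ^ p * P₀)) := h
      _ = Real.exp (|t| * ∑ q ∈ range p, δ q) * Real.exp (-(((p : ℝ) - 1) * (t * F V))) * P₀ := by
          rw [← hkey]; ring

/-- LOG FORM — THE TOTAL COUPLING DEFECT OF `p` COMPONENTS (cell record §3.3 (a) "Telescoping the logs").  When the undressed
fluctuation integrals `∫dV⌈_{Λ_q}old_q(V)` are non-zero (the printed proviso "the denominators are positive", p. 176) the
dressed ones are positive and  `|log N_{0…p−1} − Σ_q log N_q + (p − 1)·tF(V)| ≤ |t|·Σ_q δ_q`. [folklore] -/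
theorem abs_log_coupling_sum_le (p : ℕ) {s : ℕ → Finset (PBond P j)}
    (hdisj : ∀ i < p, ∀ i' < p, i ≠ i' → Disjoint (s i) (s i')) {old : ℕ → Density P j G} (F : Density P j G)
    (hm : ∀ i < p, Measurable (old i)) (hF : Measurable F) (h0 : ∀ i < p, ∀ U, 0 ≤ old i U) {C : ℝ}
    (hC : ∀ i < p, ∀ U, old i U ≤ C) (hI : ∀ i < p, ∀ i' < p, i ≠ i' → FibreIndep (s i') (old i)) {B : ℝ}
    (hFB : ∀ U, |F U| ≤ B) (t : ℝ) (δ : ℕ → ℝ) (V : GaugeField P j G)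
    (hmix : ∀ q < p, ∀ (y : ↥((range q).biUnion s) → G) (z : ↥(s q) → G),
      (∀ i < q, old i (updateFinset V ((range q).biUnion s) y) ≠ 0) → old q (updateFinset V (s q) z) ≠ 0 →
      |F (updateFinset (updateFinset V ((range q).biUnion s) y) (s q) z) - F (updateFinset V ((range q).biUnion s) y)
          - F (updateFinset V (s q) z) + F V| ≤ δ q)
    (hne : ∀ i < p, fibreIntegral (s i) (old i) V ≠ 0) :
    |Real.log (fibreIntegral ((range p).biUnion s) (fun U => (∏ i ∈ range p, old i U) * Real.exp (t * F U)) V)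
        - ∑ i ∈ range p, Real.log (fibreIntegral (s i) (fun U => old i U * Real.exp (t * F U)) V)
        + ((p : ℝ) - 1) * (t * F V)| ≤ |t| * ∑ q ∈ range p, δ q := by
  obtain ⟨hL, hU⟩ := fibreIntegral_biUnion_exp_sandwich p hdisj F hm hF h0 hC hI hFB t δ V hmix
  set a := Real.exp (-(t * F V)) with ha
  set N := fibreIntegral ((range p).biUnion s) (fun U => (∏ i ∈ range p, old i U) * Real.exp (t * F U)) V
  set S := ∑ q ∈ range p, δ q
  have ha0 : 0 < a := Real.exp_pos _
  have hn : ∀ i ∈ range p, 0 < fibreIntegral (s i) (fun U => old i U * Real.exp (t * F U)) V := fun i hi =>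
    fibreIntegral_exp_dressed_pos (s i) F (h0 i (mem_range.1 hi)) (hC i (mem_range.1 hi)) hFB t V
      (hne i (mem_range.1 hi))
  have hPpos : 0 < ∏ i ∈ range p, (a * fibreIntegral (s i) (fun U => old i U * Real.exp (t * F U)) V) :=
    prod_pos fun i hi => mul_pos ha0 (hn i hi)
  have hLpos : 0 < Real.exp (-(|t| * S)) *
      ∏ i ∈ range p, (a * fibreIntegral (s i) (fun U => old i U * Real.exp (t * F U)) V) :=
    mul_pos (Real.exp_pos _) hPpos
  have haN : 0 < a * N := lt_of_lt_of_le hLpos hL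
  have hN : 0 < N := pos_of_mul_pos_right haN ha0.le
  have hlogP : Real.log (∏ i ∈ range p, (a * fibreIntegral (s i) (fun U => old i U * Real.exp (t * F U)) V))
      = (p : ℝ) * (-(t * F V))
        + ∑ i ∈ range p, Real.log (fibreIntegral (s i) (fun U => old i U * Real.exp (t * F U)) V) := by
    rw [Real.log_prod (fun i hi => (mul_pos ha0 (hn i hi)).ne')]
    rw [show (∑ i ∈ range p, Real.log (a * fibreIntegral (s i) (fun U => old i U * Real.exp (t * F U)) V))
        = ∑ i ∈ range p, (-(t * F V) + Real.log (fibreIntegral (s i) (fun U => old i U * Real.exp (t * F U)) V)) from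
      sum_congr rfl fun i hi => by rw [Real.log_mul ha0.ne' (hn i hi).ne', ha, Real.log_exp]]
    rw [sum_add_distrib, sum_const, card_range, nsmul_eq_mul]
  have h1 := Real.log_le_log hLpos hL
  have h2 := Real.log_le_log haN hU
  rw [Real.log_mul (Real.exp_pos _).ne' hPpos.ne', Real.log_exp, hlogP, Real.log_mul ha0.ne' hN.ne', ha,
    Real.log_exp] at h1 h2
  rw [abs_le]
  constructor <;> linarith

/-- … IN D-TERM FORM (any convention `D_Λ(t;V) := log(∫⌈_Λ(old·e^{tF})(V)/∫⌈_Λ old(V)) − tF(V)`, the joint term normalised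
by the undressed joint fluctuation integral, which FACTORISES by `fibreIntegral_biUnion_prod_eq`):
`D_{∪Λ_q} = Σ_q D_{Λ_q} + R_{0…p−1}`, `|R_{0…p−1}| ≤ |t|·Σ_q δ_q` — the crude `p`-body Mayer step of the cell record
§3.3 (a): joint dressed normalisation (β) = product `∏_q` of dressed per-component factors × `e^{R}`. [folklore] -/
theorem abs_defect_biUnion_sub_sum_le (p : ℕ) {s : ℕ → Finset (PBond P j)}
    (hdisj : ∀ i < p, ∀ i' < p, i ≠ i' → Disjoint (s i) (s i')) {old : ℕ → Density P j G} (F : Density P j G)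
    (hm : ∀ i < p, Measurable (old i)) (hF : Measurable F) (h0 : ∀ i < p, ∀ U, 0 ≤ old i U) {C : ℝ}
    (hC : ∀ i < p, ∀ U, old i U ≤ C) (hI : ∀ i < p, ∀ i' < p, i ≠ i' → FibreIndep (s i') (old i)) {B : ℝ}
    (hFB : ∀ U, |F U| ≤ B) (t : ℝ) (δ : ℕ → ℝ) (V : GaugeField P j G)
    (hmix : ∀ q < p, ∀ (y : ↥((range q).biUnion s) → G) (z : ↥(s q) → G),
      (∀ i < q, old i (updateFinset V ((range q).biUnion s) y) ≠ 0) → old q (updateFinset V (s q) z) ≠ 0 →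
      |F (updateFinset (updateFinset V ((range q).biUnion s) y) (s q) z) - F (updateFinset V ((range q).biUnion s) y)
          - F (updateFinset V (s q) z) + F V| ≤ δ q)
    (hne : ∀ i < p, fibreIntegral (s i) (old i) V ≠ 0) :
    |(Real.log (fibreIntegral ((range p).biUnion s) (fun U => (∏ i ∈ range p, old i U) * Real.exp (t * F U)) V
          / fibreIntegral ((range p).biUnion s) (fun U => ∏ i ∈ range p, old i U) V) - t * F V)
      - ∑ i ∈ range p, (Real.log (fibreIntegral (s i) (fun U => old i U * Real.exp (t * F U)) V
          / fibreIntegral (s i) (old i) V) - t * F V)| ≤ |t| * ∑ q ∈ range p, δ q := by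
  have h := abs_log_coupling_sum_le p hdisj F hm hF h0 hC hI hFB t δ V hmix hne
  have hn : ∀ i ∈ range p, 0 < fibreIntegral (s i) (fun U => old i U * Real.exp (t * F U)) V := fun i hi =>
    fibreIntegral_exp_dressed_pos (s i) F (h0 i (mem_range.1 hi)) (hC i (mem_range.1 hi)) hFB t V
      (hne i (mem_range.1 hi))
  have hne' : ∀ i ∈ range p, fibreIntegral (s i) (old i) V ≠ 0 := fun i hi => hne i (mem_range.1 hi)
  obtain ⟨hL, -⟩ := fibreIntegral_biUnion_exp_sandwich p hdisj F hm hF h0 hC hI hFB t δ V hmix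
  have hLpos : 0 < Real.exp (-(|t| * ∑ q ∈ range p, δ q)) *
      ∏ i ∈ range p, (Real.exp (-(t * F V)) * fibreIntegral (s i) (fun U => old i U * Real.exp (t * F U)) V) :=
    mul_pos (Real.exp_pos _) (prod_pos fun i hi => mul_pos (Real.exp_pos _) (hn i hi))
  have hN : 0 < fibreIntegral ((range p).biUnion s) (fun U => (∏ i ∈ range p, old i U) * Real.exp (t * F U)) V :=
    pos_of_mul_pos_right (lt_of_lt_of_le hLpos hL) (Real.exp_pos _).le
  have hPne : ∏ i ∈ range p, fibreIntegral (s i) (old i) V ≠ 0 := prod_ne_zero_iff.2 hne'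
  have hsum : ∑ i ∈ range p, (Real.log (fibreIntegral (s i) (fun U => old i U * Real.exp (t * F U)) V
          / fibreIntegral (s i) (old i) V) - t * F V)
      = ∑ i ∈ range p, Real.log (fibreIntegral (s i) (fun U => old i U * Real.exp (t * F U)) V)
          - ∑ i ∈ range p, Real.log (fibreIntegral (s i) (old i) V) - (p : ℝ) * (t * F V) := by
    have hc : ∑ _i ∈ range p, t * F V = (p : ℝ) * (t * F V) := by rw [sum_const, card_range, nsmul_eq_mul]
    rw [← hc, ← sum_sub_distrib, ← sum_sub_distrib]
    exact sum_congr rfl fun i hi => by rw [Real.log_div (hn i hi).ne' (hne' i hi)]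
  rw [fibreIntegral_biUnion_prod_eq p hdisj hm h0 hC hI V, Real.log_div hN.ne' hPne, Real.log_prod hne', hsum]
  refine le_of_eq_of_le (congrArg _ ?_) h
  ring

end SetupLevel

/-! ## §3 Where NE1 (ii) is spent for `p` components: the total coupling remainder of the loop dressing in one unit block -/

section Consumer

variable {P : Params} {j : ℕ} {G : Type*} [GaugeGroup G] [MeasurableSpace G] [HaarData G]
variable [DecidableEq (PBond P j)]

/-- THE UNION RULE FOR THE PAIR SHAPE (the shape `LoopPairOscBound` is LINEAR in `|Λ|`): the prefix remainder
`δ_q = C₂·|w|·|Λ₀ ∪ ⋯ ∪ Λ_{q−1}|·|Λ_q|·θ₂ⁿ` of a pairwise-disjoint family equals `C₂·|w|·θ₂ⁿ·Σ_{i<q}|Λᵢ|·|Λ_q|`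
(`Finset.card_biUnion`). [folklore] -/
theorem prefix_pair_remainder_eq {p : ℕ} {s : ℕ → Finset (PBond P j)}
    (hdisj : ∀ i < p, ∀ i' < p, i ≠ i' → Disjoint (s i) (s i')) (C₂ ℓ θn : ℝ) {q : ℕ} (hq : q ≤ p) :
    C₂ * ℓ * (((range q).biUnion s).card : ℝ) * ((s q).card : ℝ) * θn
      = C₂ * ℓ * θn * ∑ i ∈ range q, ((s i).card : ℝ) * ((s q).card : ℝ) := by
  rw [card_biUnion (fun i hi i' hi' hne => hdisj i (lt_of_lt_of_le (mem_range.1 (mem_coe.1 hi)) hq) i'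
    (lt_of_lt_of_le (mem_range.1 (mem_coe.1 hi')) hq) hne)]
  push_cast
  rw [← sum_mul]
  ring

/-- … so the accumulated remainder of the `p`-body sandwich is `|t|·C₂·|w|·θ₂ⁿ·Σ_{i<i′}|Λᵢ|·|Λ_{i′}|`. [folklore] -/
theorem sum_prefix_pair_remainder_eq {p : ℕ} {s : ℕ → Finset (PBond P j)}
    (hdisj : ∀ i < p, ∀ i' < p, i ≠ i' → Disjoint (s i) (s i')) (C₂ ℓ θn : ℝ) :
    ∑ q ∈ range p, C₂ * ℓ * (((range q).biUnion s).card : ℝ) * ((s q).card : ℝ) * θn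
      = C₂ * ℓ * θn * ∑ q ∈ range p, ∑ i ∈ range q, ((s i).card : ℝ) * ((s q).card : ℝ) := by
  rw [mul_sum]
  exact sum_congr rfl fun q hq => prefix_pair_remainder_eq hdisj C₂ ℓ θn (mem_range.1 hq).le

/-- WHERE NE1 (ii) IS SPENT FOR `p` COMPONENTS (one basic step, one term, `p` components; cell record `t4/T4-EST-O3Eii.md`
§3.3 (a)): under `LoopPairOscBound av dom C₂ θ₂`, for a closed walk at level `j + n ≤ m + K`, pairwise-disjoint integration
domains `Λ₀, …, Λ_{p−1}`, integrated densities `old_q` (independent of the other fibres) SUPPORTED IN THE DOMAIN `dom j` and a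
base point `V ∈ dom j`, the dressing `e^{t·W_C(avg^n ·)}` (`T4OscSandwich.loopDressing`) satisfies the `p`-body coupling
sandwich of §2 with the accumulated remainder  `Σ_q δ_q = C₂·|w|·θ₂ⁿ·Σ_{i<i′}|Λᵢ|·|Λ_{i′}|`  (normalised currency:
`e^{−|t|Σδ}·∏_q Ñ_q ≤ Ñ_{0…p−1} ≤ e^{|t|Σδ}·∏_q Ñ_q`). [folklore] -/
theorem fibreIntegral_biUnion_loopDressing_sandwich [RegularGaugeGroup G] {av : ∀ i, Averaging P i G}
    {dom : ∀ i, Set (GaugeField P i G)} {C₂ θ₂ : ℝ} (hW : LoopPairOscBound av dom C₂ θ₂)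
    (n : ℕ) (hn : j + n ≤ P.m + P.K) (x : Site P (j + n)) (w : List (Letter P.d)) (hw : walkEnd x w = x)
    (hFm : Measurable (loopDressing av j n x w)) (p : ℕ) {s : ℕ → Finset (PBond P j)}
    (hdisj : ∀ i < p, ∀ i' < p, i ≠ i' → Disjoint (s i) (s i')) {old : ℕ → Density P j G}
    (hm : ∀ i < p, Measurable (old i)) (h0 : ∀ i < p, ∀ U, 0 ≤ old i U) {C : ℝ} (hC : ∀ i < p, ∀ U, old i U ≤ C)
    (hI : ∀ i < p, ∀ i' < p, i ≠ i' → FibreIndep (s i') (old i)) (hdom : ∀ i < p, ∀ U, old i U ≠ 0 → U ∈ dom j)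
    (t : ℝ) (V : GaugeField P j G) (hV : V ∈ dom j) :
    Real.exp (-(|t| * (C₂ * (w.length : ℝ) * θ₂ ^ n *
          ∑ q ∈ range p, ∑ i ∈ range q, ((s i).card : ℝ) * ((s q).card : ℝ)))) *
        ∏ i ∈ range p, (Real.exp (-(t * loopDressing av j n x w V)) *
          fibreIntegral (s i) (fun U => old i U * Real.exp (t * loopDressing av j n x w U)) V)
      ≤ Real.exp (-(t * loopDressing av j n x w V)) *
        fibreIntegral ((range p).biUnion s)
          (fun U => (∏ i ∈ range p, old i U) * Real.exp (t * loopDressing av j n x w U)) V ∧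
    Real.exp (-(t * loopDressing av j n x w V)) *
        fibreIntegral ((range p).biUnion s)
          (fun U => (∏ i ∈ range p, old i U) * Real.exp (t * loopDressing av j n x w U)) V
      ≤ Real.exp (|t| * (C₂ * (w.length : ℝ) * θ₂ ^ n *
          ∑ q ∈ range p, ∑ i ∈ range q, ((s i).card : ℝ) * ((s q).card : ℝ))) *
        ∏ i ∈ range p, (Real.exp (-(t * loopDressing av j n x w V)) *
          fibreIntegral (s i) (fun U => old i U * Real.exp (t * loopDressing av j n x w U)) V) := by
  rw [← sum_prefix_pair_remainder_eq hdisj C₂ (w.length : ℝ) (θ₂ ^ n)]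
  refine fibreIntegral_biUnion_exp_sandwich p hdisj (loopDressing av j n x w) hm hFm h0 hC hI (B := 1)
    (fun U => abs_loopAt_le_one _ _) t _ V (fun q hq y z hy hz => ?_)
  have hd : Disjoint ((range q).biUnion s) (s q) := disjoint_biUnion_range hdisj hq
  have hV₂ : updateFinset V (s q) z ∈ dom j := hdom q hq _ hz
  have hV₁ : updateFinset V ((range q).biUnion s) y ∈ dom j := by
    rcases Nat.eq_zero_or_pos q with rfl | hq0
    · rw [updateFinset_eq_self_of_forall_not_mem V (fun b => by simp) y]; exact hV
    · exact hdom 0 (hq0.trans hq) _ (hy 0 hq0)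
  have hV₁₂ : updateFinset (updateFinset V ((range q).biUnion s) y) (s q) z ∈ dom j := by
    refine hdom q hq _ ?_
    rw [updateFinset_updateFinset_comm hd V y z, fibreIndep_biUnion_range hI hq _ y]
    exact hz
  exact hW.updateFinset n hn x w hw hd V y z hV hV₁ hV₂ hV₁₂

/-- LOG FORM of the consumer: under `LoopPairOscBound`, with the undressed fluctuation integrals non-zero,
`|log N_{0…p−1} − Σ_q log N_q + (p−1)·tW(V)| ≤ |t|·C₂·|w|·θ₂ⁿ·Σ_{i<i′}|Λᵢ|·|Λ_{i′}|` — the TOTAL coupling of the block's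
`p` components is controlled by the pair shape alone (cell record §3.3 (a); no convergence condition involved). [folklore] -/
theorem abs_log_loopDressing_coupling_sum_le [RegularGaugeGroup G] {av : ∀ i, Averaging P i G}
    {dom : ∀ i, Set (GaugeField P i G)} {C₂ θ₂ : ℝ} (hW : LoopPairOscBound av dom C₂ θ₂)
    (n : ℕ) (hn : j + n ≤ P.m + P.K) (x : Site P (j + n)) (w : List (Letter P.d)) (hw : walkEnd x w = x)
    (hFm : Measurable (loopDressing av j n x w)) (p : ℕ) {s : ℕ → Finset (PBond P j)}
    (hdisj : ∀ i < p, ∀ i' < p, i ≠ i' → Disjoint (s i) (s i')) {old : ℕ → Density P j G}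
    (hm : ∀ i < p, Measurable (old i)) (h0 : ∀ i < p, ∀ U, 0 ≤ old i U) {C : ℝ} (hC : ∀ i < p, ∀ U, old i U ≤ C)
    (hI : ∀ i < p, ∀ i' < p, i ≠ i' → FibreIndep (s i') (old i)) (hdom : ∀ i < p, ∀ U, old i U ≠ 0 → U ∈ dom j)
    (t : ℝ) (V : GaugeField P j G) (hV : V ∈ dom j) (hne : ∀ i < p, fibreIntegral (s i) (old i) V ≠ 0) :
    |Real.log (fibreIntegral ((range p).biUnion s)
          (fun U => (∏ i ∈ range p, old i U) * Real.exp (t * loopDressing av j n x w U)) V)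
        - ∑ i ∈ range p, Real.log (fibreIntegral (s i) (fun U => old i U * Real.exp (t * loopDressing av j n x w U)) V)
        + ((p : ℝ) - 1) * (t * loopDressing av j n x w V)|
      ≤ |t| * (C₂ * (w.length : ℝ) * θ₂ ^ n * ∑ q ∈ range p, ∑ i ∈ range q, ((s i).card : ℝ) * ((s q).card : ℝ)) := by
  rw [← sum_prefix_pair_remainder_eq hdisj C₂ (w.length : ℝ) (θ₂ ^ n)]
  refine abs_log_coupling_sum_le p hdisj (loopDressing av j n x w) hm hFm h0 hC hI (B := 1)
    (fun U => abs_loopAt_le_one _ _) t _ V (fun q hq y z hy hz => ?_) hne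
  have hd : Disjoint ((range q).biUnion s) (s q) := disjoint_biUnion_range hdisj hq
  have hV₂ : updateFinset V (s q) z ∈ dom j := hdom q hq _ hz
  have hV₁ : updateFinset V ((range q).biUnion s) y ∈ dom j := by
    rcases Nat.eq_zero_or_pos q with rfl | hq0
    · rw [updateFinset_eq_self_of_forall_not_mem V (fun b => by simp) y]; exact hV
    · exact hdom 0 (hq0.trans hq) _ (hy 0 hq0)
  have hV₁₂ : updateFinset (updateFinset V ((range q).biUnion s) y) (s q) z ∈ dom j := by
    refine hdom q hq _ ?_
    rw [updateFinset_updateFinset_comm hd V y z, fibreIndep_biUnion_range hI hq _ y]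
    exact hz
  exact hW.updateFinset n hn x w hw hd V y z hV hV₁ hV₂ hV₁₂

end Consumer

/-! ## §4 Counting the pairs of one block [arith] -/

section Counting

/-- THE PAIR COUNT IS HALF A SQUARE: `2·Σ_{q<p}Σ_{i<q} aᵢa_q + Σ_q a_q² = (Σ_q a_q)²`. [folklore] -/
theorem two_mul_sum_sum_range_add_sum_sq (a : ℕ → ℝ) (p : ℕ) :
    2 * (∑ q ∈ range p, ∑ i ∈ range q, a i * a q) + ∑ q ∈ range p, a q ^ 2 = (∑ q ∈ range p, a q) ^ 2 := by
  induction p with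
  | zero => simp
  | succ p ih =>
    rw [sum_range_succ, sum_range_succ, sum_range_succ (fun q => a q), ← sum_mul]
    nlinarith [ih]

/-- … hence for non-negative sizes `Σ_{q<p}Σ_{i<q} aᵢa_q ≤ (Σ_q a_q)²/2`. [folklore] -/
theorem sum_sum_range_mul_le_sq_half (a : ℕ → ℝ) (p : ℕ) :
    ∑ q ∈ range p, ∑ i ∈ range q, a i * a q ≤ (∑ q ∈ range p, a q) ^ 2 / 2 := by
  have h := two_mul_sum_sum_range_add_sum_sq a p
  have h2 : 0 ≤ ∑ q ∈ range p, a q ^ 2 := sum_nonneg fun q _ => sq_nonneg (a q)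
  linarith

/-- … and with a uniform bound `aᵢ ≤ Λmax` on the component sizes (`0 ≤ aᵢ`), `Σ_{q<p}Σ_{i<q} aᵢa_q ≤ Λmax²·p(p−1)/2`
(cell record §3.4 (i): the total coupling per block is at most `|t|·C₂|w|θ₂ⁿ·Λmax²·p_□²/2`). [folklore] -/
theorem sum_sum_range_mul_le_of_le (a : ℕ → ℝ) {M : ℝ} (p : ℕ) (h0 : ∀ i < p, 0 ≤ a i) (hM : ∀ i < p, a i ≤ M) :
    ∑ q ∈ range p, ∑ i ∈ range q, a i * a q ≤ M ^ 2 * ((p : ℝ) * ((p : ℝ) - 1) / 2) := by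
  induction p with
  | zero => simp
  | succ p ih =>
    have hp : p < p + 1 := Nat.lt_succ_self p
    have ih' := ih (fun i hi => h0 i (hi.trans hp)) (fun i hi => hM i (hi.trans hp))
    have hM0 : 0 ≤ M := (h0 p hp).trans (hM p hp)
    have hlast : ∑ i ∈ range p, a i * a p ≤ ∑ _i ∈ range p, M * M :=
      sum_le_sum fun i hi => mul_le_mul (hM i ((mem_range.1 hi).trans hp)) (hM p hp) (h0 p hp) hM0
    rw [sum_const, card_range, nsmul_eq_mul] at hlast
    rw [sum_range_succ]
    push_cast
    nlinarith [ih', hlast]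

end Counting

end Literature.MathematicalPhysics.QuantumFieldTheory.Balaban1983to89.T4JointDressingMany
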